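import Summits.QuantumFields.BalabanUV.Beta.CompositeOneShotJetData

/-!
# `BalabanUV.Beta.NVertexChartGenericObjects` — row D1 ∕ (C1): THE N-SYSTEM's FIRST- AND SECOND-ORDER FAMILIES THROUGH A GENERIC CHART `A`
# (`VNA R P A j := vertexOfK A (Lc^(j+1)) (JNat R P (j+1)).S`, `WNA R P A j := WchartOf (fun _ => A) (tabsComp (j+1) …) (P.c• (j+1)) 0`) — OBJECTS ONLY

WHY.  PART 11–29 (`NVertex*`) read the composite N-system `VN R P j ∕ WN R P j` (F6d-2 `CompositeOneShotJetData`) through the record's ROOTED chart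
`AN R j = compChart R.rc Lc (j+1) (R.s (j+1)) (Lc^(j+1))`.  Every one of those statements depends on the chart only through three displayed properties
(spread, block covariance, graded symmetry) and two form identities; stating them at a GENERIC chart `A : MKer (3+1) (Fib 3)` needs the two families
as objects with the chart as an ARGUMENT.  This file declares exactly those two objects and their `rfl` controls at the record chart — nothing else
(no theorem about `A`, no letter, no estimate).  At `A := AN R j` they ARE `VN R P j ∕ WN R P j` (`rfl`); the first-order stencils `(JNat R P (j+1)).S`
and the record tables `tabsComp (j+1)` ∕ pins `P.c• (j+1)` are the record's, untouched (the depth-0 stencils do not read the chart).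

WHAT ([our object — bookkeeping]; two `def`s + four `rfl` theorems; nothing cited; 0 sorry): `VNA`, `VNA_eq`, `VNA_AN`; `WNA`, `WNA_eq`, `WNA_AN`.
WHAT THIS IS NOT: not a chart, not a corrector, not a discharge of anything; nothing of Bałaban's asserted, valued or discharged; 0 estimates; 0∕4 row-D1
binders (hW, hR, D1Tel, D1Rep); ROOT M‴ p325680 ∕ P5c ∕ D6 untouched; NOT (C1), NOT (T-ID), NOT D1, NEVER «G-an2-4 closed», NOT BetaPertH, NOT continuum, NOT Clay.

HONEST DEPENDENCY (page 1, mandatory): continuum YM on T⁴ ⇐ BetaPertH ∧ nine spine estimates (0/9 proved); BetaPertH ⇐ (D1) ∧ (D4) ∧ CAP+tail;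
G-an2-4 gates asym, D1 and NE2/3/4.  HONEST FRAMING (cell contract, verbatim): «discharging `BetaPertH` makes Bałaban's UV stability UNCONDITIONAL —
a real constructive-QFT result; it is NOT the continuum limit and NOT the Clay problem.»  ABSOLUTE RULE (cell charter, verbatim): «No internally-minted
statement may enter as a cited fact. Every hypothesis is either kernel-proved in this package or a verbatim quotation of a PUBLISHED theorem with page
reference. The manuscript(s) under audit are NOT citable for their own disputed steps — they are the thing under adjudication; programme-internal
(2001/route/tribunal) claims are never citable.»  Row D1 ∕ (C1) OWNER an2 (b2b-balaban-beta-an2) gen 92, 2026-08-31.  No existing file touched.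
-/

noncomputable section

namespace Summit.QuantumFields.BalabanUV.Beta.NVertexChartGenericObjects

open Literature.MathematicalPhysics.QuantumFieldTheory
open Literature.MathematicalPhysics.QuantumFieldTheory.Balaban1983to89
open Literature.MathematicalPhysics.QuantumFieldTheory.Balaban1983to89.Beta
open ExpKernelCalculus (MKer)
open AffineAveraging (Site)
open OneStepResolventKernel (Fib)
open OneStepKernelFamily (vertexOfK)
open Summit.QuantumFields.BalabanUV.Beta.AxialDressingRooted (one_le_of_neZero)
open Summit.QuantumFields.BalabanUV.Beta.ChartStepJets (WchartOf)
open Summit.QuantumFields.BalabanUV.Beta.CompositeOneShotJets (tabsComp)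
open Summit.QuantumFields.BalabanUV.Beta.CompositeOneShotJetData (Roots Pins AN VN WN JNat)

variable {Lc : ℕ} [NeZero Lc] (R : Roots Lc) (P : Pins) (A : MKer (3 + 1) (Fib 3)) (j : ℕ)

/-- [our object — bookkeeping] **`VNA R P A j`** — the N-system's FIRST-ORDER family at depth `j+1` through a GENERIC chart `A`: the chain-rule vertex of `A` at blocking
`Lc^(j+1)` over the record's first-order stencils `(JNat R P (j+1)).S` (`CompositeOneShotJetData.VN R P j` is the value at `A := AN R j`). -/
def VNA : Fin (3 + 1) → Site (3 + 1) → MKer (3 + 1) (Fib 3) :=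
  vertexOfK A (Lc ^ (j + 1)) (JNat R P (j + 1)).S

/-- `VNA` unfolded (`rfl`). -/
theorem VNA_eq : VNA R P A j = vertexOfK A (Lc ^ (j + 1)) (JNat R P (j + 1)).S := rfl

/-- (II) CONTROL (`rfl` through `VN_eq`): at the record chart the generic first-order family IS `VN R P j`. -/
theorem VNA_AN : VNA R P (AN R j) j = VN R P j := rfl

/-- [our object — bookkeeping] **`WNA R P A j`** — the N-system's SECOND-ORDER family at depth `j+1` through a GENERIC chart `A`: F6d-1a `ChartStepJets.WchartOf` over the
record's slotted tables `tabsComp (j+1)` and pins `P.c• (j+1)` with the constant chart family `fun _ => A` (`CompositeOneShotJetData.WN R P j` is the value at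
`A := AN R j`; the decay witness of `JsChart0Of` never enters `W`). -/
def WNA : Fin (3 + 1) → Site (3 + 1) → Fin (3 + 1) → Site (3 + 1) → MKer (3 + 1) (Fib 3) :=
  WchartOf (fun _ => A) (tabsComp (j + 1) (one_le_of_neZero Lc) R.hr (P.cM (j + 1)))
    (P.cE (j + 1)) (P.cVH (j + 1)) (P.cΛ (j + 1)) (P.cE₂ (j + 1)) (P.cB (j + 1)) (P.T (j + 1)) 0

/-- `WNA` unfolded (`rfl`). -/
theorem WNA_eq : WNA R P A j = WchartOf (fun _ => A) (tabsComp (j + 1) (one_le_of_neZero Lc) R.hr (P.cM (j + 1)))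
    (P.cE (j + 1)) (P.cVH (j + 1)) (P.cΛ (j + 1)) (P.cE₂ (j + 1)) (P.cB (j + 1)) (P.T (j + 1)) 0 := rfl

/-- (II) CONTROL (`rfl` through `WN_eq ∕ JNat_W`): at the record chart the generic second-order family IS `WN R P j`. -/
theorem WNA_AN : WNA R P (AN R j) j = WN R P j := rfl

end Summit.QuantumFields.BalabanUV.Beta.NVertexChartGenericObjects

end
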